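import Literature.AlgebraicGeometry.Frobenioids.ModelFrobenioidPreFrobenioid
import Literature.AlgebraicGeometry.Frobenioids.ModelFrobenioidFunctorIso
import HarnessLib

/-!
# Frobenioids I, Thm. 5.2 / Prop. 5.6: rigidity of self-equivalences of a model Frobenioid lying
# over the identity of the base (the [IUTchI] Cor. 5.3 (iv) injectivity criterion, p. 145 l. 1–9)

Mochizuki, *The geometry of Frobenioids I: the general theory*, Kyushu J. Math. **62** (2008)
293–400, §5: the model Frobenioid of Theorem 5.2 (i) p. 100 (a morphism IS the quadruple
`(deg_Fr, Base, Div, u)` subject to relation (d), `ModelFrobenioid.lean`), the comparison equivalence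
of Theorem 5.2 (iv) pp. 101–103 and the base-Frobenius pairs of Proposition 5.6 p. 105 ("determined …
up to conjugation [as a pair!] by an element of `O^×(A)`") [cite: MochizukiFrdI2008, Thm. 5.2 p.100];
consumer locus: Mochizuki, *Inter-universal Teichmüller theory I*, proof of Corollary 5.3 (iv),
kurims manuscript p. 144 l. 42 – p. 145 l. 9 [cite: Mochizuki2012, Cor. 5.3(iv) p.145]:

> "I claim that to show that `α` is [isomorphic to — cf. §0] the identity self-equivalence of `ℱ̲_v`, it
> suffices to verify that `α` induces […] the identity on the rational function and divisor monoids of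
> `ℱ̲_v`." — "… it follows, by arguing as in the construction of the equivalence of categories given
> in the proof of [FrdI], Theorem 5.2, (iv), that the various units obtained in [FrdI], Proposition
> 5.6, determine […] an isomorphism between `α` and the identity self-equivalence of `ℱ̲_v`, as
> desired."

PROOF-ONLY (abc-iut cell; row «C53iv/S2 FRDI-SELFEQUIV-RIGIDITY» of
`plan/L5` census `SUBDAG-IUTchI-Cor53.md` §D/§R, typer of record abc-iut-L5-t4; this file abc-iut-L1-t7).
THE THEOREM, at the level of the model Frobenioid `C` of `(Φ, B, Div_B)` on `D` (no hypothesis on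
`Φ`, `B`, `Div_B`, `D`): let `Ψ : C ⥤ C` be a functor (in print a self-equivalence) LYING OVER THE
IDENTITY OF `D` — a natural family of base isomorphisms `e_X : Base(Ψ X) ⥲ Base(X)` with
`Base(Ψ φ) ≫ e_Y = e_X ≫ Base(φ)` (equivalently an isomorphism `η : Ψ ⋙ Base ≅ Base`) — that preserves
Frobenius degrees and INDUCES THE IDENTITY ON THE DIVISOR MONOID `Φ` AND ON THE RATIONAL FUNCTION
MONOID `B` through `e`: `Div(Ψ φ) = e_X^* Div(φ)`, `u_{Ψ φ} = e_X^* u_φ`.  Then `Ψ ≅ 𝟭_C`, by an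
isomorphism whose components are `(1, e_X, 0, 1)` (`exists_iso_id_of_over_base`,
`nonempty_iso_id_of_over_baseIso`, `selfEquivalence_iso_id_of_over_base`).

THE ARGUMENT (the model-level form of print's "units of Proposition 5.6"): the only datum of `Ψ` not
fixed by the hypotheses is the class `cls(Ψ X) ∈ Φ(Base Ψ X)^gp` of the image object; its
DISCREPANCY `c_X := e_X⁻¹^* cls(Ψ X) − cls(X) ∈ Φ(Base X)^gp` satisfies, by relation (d) of
Thm. 5.2 (i) for `φ` and for `Ψ φ` (`rel_map_pullGp_baseIso`), `deg_Fr(φ) · c_X = Base(φ)^* c_Y` along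
EVERY morphism `φ : X → Y` (`baseDiscr_pow_eq`).  Along the pre-steps `(1, id, z, 1) : (A, α) → (A, α + z)`
this makes `c` constant on each fibre `{(A, α)}_α` (`baseDiscr_eq_of_base_eq`, every class being a
difference of elements of `Φ(A)`); along the degree-`2` Frobenius morphism `(2, id, 0, 1) : (A, α) →
(A, 2α)` — the restriction to `(A, α)` of the base-Frobenius pair of the proof of Thm. 5.2 (iii) — it
gives `2 · c = c`, i.e. `c = 0` (`baseDiscr_eq_one`; print's Rmk. 5.3.3 relation `c_p = c_2^{p-1}` at
`p = 2` with trivial unit part).  Hence `cls(Ψ X) = e_X^* cls(X)` (`cls_obj_eq_pullGp_of_over_base`) and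
`(1, e_X, 0, 1) : Ψ X → X` is a natural isomorphism.  No statement of either paper is restated as a
fact; nothing here bears on [IUTchIII] Cor. 3.12; a theorem about OUR model category.
-/

namespace Literature.AlgebraicGeometry.Frobenioids

open CategoryTheory Opposite

universe w v u

namespace ModelFrobenioid

/-- Dividing two instances of relation (d) with the same divisor and unit terms: from
`x ^ d · z = a · s` and `p ^ d · z = q · s` in a commutative group, `(x / p) ^ d = a / q`. [folklore] -/
private theorem div_pow_eq_of_two_rels {G : Type*} [CommGroup G] {x p z a q s : G} {d : ℕ}
    (h₁ : x ^ d * z = a * s) (h₂ : p ^ d * z = q * s) : (x / p) ^ d = a / q := by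
  rw [div_pow, eq_mul_inv_of_mul_eq h₁, eq_mul_inv_of_mul_eq h₂, mul_div_mul_right_eq_div,
    mul_div_mul_right_eq_div]

variable {D : Type u} [Category.{v} D] {Φ B : Dᵒᵖ ⥤ CommMonCat.{w}} {DivB : B ⟶ monoidGp Φ}
  {Ψ : ModelFrobenioid Φ B DivB ⥤ ModelFrobenioid Φ B DivB}
  (e : ∀ X : ModelFrobenioid Φ B DivB, (Ψ.obj X).base ≅ X.base)
  (hen : ∀ ⦃X Y : ModelFrobenioid Φ B DivB⦄ (φ : X ⟶ Y),
    baseMap (Ψ.map φ) ≫ (e Y).hom = (e X).hom ≫ baseMap φ)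

section Discrepancy

include hen

/-- Naturality of the inverse base identification `e_X⁻¹ : Base(X) ⥲ Base(Ψ X)` of a functor lying over
the identity of `D`. [cite: MochizukiFrdI2008, Thm. 5.2(iv) p.102] -/
theorem baseIso_inv_naturality {X Y : ModelFrobenioid Φ B DivB} (φ : X ⟶ Y) :
    baseMap φ ≫ (e Y).inv = (e X).inv ≫ baseMap (Ψ.map φ) := by
  rw [Iso.comp_inv_eq, Category.assoc, Iso.eq_inv_comp]
  exact (hen φ).symm

variable (hdeg : ∀ ⦃X Y : ModelFrobenioid Φ B DivB⦄ (φ : X ⟶ Y), degFr (Ψ.map φ) = degFr φ)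
  (hdiv : ∀ ⦃X Y : ModelFrobenioid Φ B DivB⦄ (φ : X ⟶ Y),
    div (Ψ.map φ) = pull Φ (e X).hom (div φ))
  (hunit : ∀ ⦃X Y : ModelFrobenioid Φ B DivB⦄ (φ : X ⟶ Y),
    unit (Ψ.map φ) = pull B (e X).hom (unit φ))

include hdeg hdiv hunit

/-- **Relation (d) for `Ψ φ`, pulled back to `Base(X)` along `e_X⁻¹`**: with `Div(Ψ φ) = e_X^* Div(φ)` and
`u_{Ψ φ} = e_X^* u_φ` it reads `deg_Fr(φ) · (e_X⁻¹)^* cls(Ψ X) + Div(φ) =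
Base(φ)^* (e_Y⁻¹)^* cls(Ψ Y) + Div_B(u_φ)` — relation (d) of `φ` with the classes of `X`, `Y` replaced by
the transported classes of `Ψ X`, `Ψ Y`. [cite: MochizukiFrdI2008, Thm. 5.2(i) p.100] -/
theorem rel_map_pullGp_baseIso {X Y : ModelFrobenioid Φ B DivB} (φ : X ⟶ Y) :
    pullGp Φ (e X).inv (Ψ.obj X).cls ^ (degFr φ : ℕ) * Algebra.GrothendieckGroup.of (div φ) =
      pullGp Φ (baseMap φ) (pullGp Φ (e Y).inv (Ψ.obj Y).cls) *
        divB Φ B DivB (op X.base) (unit φ) := by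
  have h := congrArg (pullGp Φ (e X).inv) (rel (Ψ.map φ))
  rw [map_mul, map_pow, map_mul, pullGp_of, pullGp_divB, ← pullGp_comp,
    ← baseIso_inv_naturality e hen φ, pullGp_comp, hdeg, hdiv, hunit] at h
  have h₁ : (Φ.map (e X).inv.op).hom (pull Φ (e X).hom (div φ)) = div φ := by
    show pull Φ (e X).inv (pull Φ (e X).hom (div φ)) = div φ
    rw [← pull_comp, Iso.inv_hom_id, pull_id]
  have h₂ : (B.map (e X).inv.op).hom (pull B (e X).hom (unit φ)) = unit φ := by
    show pull B (e X).inv (pull B (e X).hom (unit φ)) = unit φ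
    rw [← pull_comp, Iso.inv_hom_id, pull_id]
  rw [h₁, h₂] at h
  exact h

/-- **The discrepancy law**: for `c_X := (e_X⁻¹)^* cls(Ψ X) − cls(X) ∈ Φ(Base X)^gp` and every morphism
`φ : X → Y`, `deg_Fr(φ) · c_X = Base(φ)^* c_Y` (relation (d) for `Ψ φ` minus relation (d) for `φ`).
[cite: MochizukiFrdI2008, Thm. 5.2(iv) p.102] -/
theorem baseDiscr_pow_eq {X Y : ModelFrobenioid Φ B DivB} (φ : X ⟶ Y) :
    (pullGp Φ (e X).inv (Ψ.obj X).cls / X.cls) ^ (degFr φ : ℕ) =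
      pullGp Φ (baseMap φ) (pullGp Φ (e Y).inv (Ψ.obj Y).cls / Y.cls) := by
  rw [map_div]
  exact div_pow_eq_of_two_rels (rel_map_pullGp_baseIso e hen hdeg hdiv hunit φ) (rel φ)

/-- The discrepancy is unchanged along the pre-step `(1, id, z, 1) : (A, α) → (A, α + z)`.
[cite: MochizukiFrdI2008, Thm. 5.2(iv) p.102] -/
theorem baseDiscr_eq_of_mul_of (A : D) (α : Algebra.GrothendieckGroup (Φ.obj (op A)))
    (z : Φ.obj (op A)) :
    pullGp Φ (e ⟨A, α⟩).inv (Ψ.obj ⟨A, α⟩).cls / α =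
      pullGp Φ (e ⟨A, α * Algebra.GrothendieckGroup.of z⟩).inv
          (Ψ.obj ⟨A, α * Algebra.GrothendieckGroup.of z⟩).cls / (α * Algebra.GrothendieckGroup.of z) := by
  -- the pre-step `(1, id, z, 1) : (A, α) → (A, α + z)`
  let s : (⟨A, α⟩ : ModelFrobenioid Φ B DivB) ⟶ ⟨A, α * Algebra.GrothendieckGroup.of z⟩ :=
    { degFr := 1
      base := 𝟙 A
      div := z
      unit := 1
      rel := by
        show α ^ ((1 : ℕ+) : ℕ) * _ = pullGp Φ (𝟙 A) (α * Algebra.GrothendieckGroup.of z) * _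
        rw [PNat.one_coe, pow_one, pullGp_id, map_one, mul_one] }
  have h := baseDiscr_pow_eq e hen hdeg hdiv hunit s
  rw [show degFr s = 1 from rfl, PNat.one_coe, pow_one, show baseMap s = 𝟙 A from rfl, pullGp_id] at h
  exact h

/-- The discrepancy is multiplied by `2` — hence unchanged, once it is known to be constant on the fibre —
along the degree-`2` Frobenius morphism `(2, id, 0, 1) : (A, α) → (A, 2α)` (the base-Frobenius pair of the
proof of Thm. 5.2 (iii) restricted to `(A, α)`): `2 · c_{(A, α)} = c_{(A, 2α)}`.
[cite: MochizukiFrdI2008, Thm. 5.2(iii) p.101] -/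
theorem baseDiscr_sq_eq_of_frobenius (A : D) (α : Algebra.GrothendieckGroup (Φ.obj (op A))) :
    (pullGp Φ (e ⟨A, α⟩).inv (Ψ.obj ⟨A, α⟩).cls / α) ^ 2 =
      pullGp Φ (e ⟨A, α ^ 2⟩).inv (Ψ.obj ⟨A, α ^ 2⟩).cls / α ^ 2 := by
  -- the Frobenius morphism `(2, id, 0, 1) : (A, α) → (A, 2α)`
  let f : (⟨A, α⟩ : ModelFrobenioid Φ B DivB) ⟶ ⟨A, α ^ 2⟩ :=
    { degFr := 2
      base := 𝟙 A
      div := 1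
      unit := 1
      rel := by
        show α ^ ((2 : ℕ+) : ℕ) * _ = pullGp Φ (𝟙 A) (α ^ 2) * _
        rw [map_one, mul_one, map_one, mul_one, pullGp_id]
        rfl }
  have h := baseDiscr_pow_eq e hen hdeg hdiv hunit f
  rw [show degFr f = 2 from rfl, show (((2 : ℕ+) : ℕ)) = 2 from rfl, show baseMap f = 𝟙 A from rfl,
    pullGp_id] at h
  exact h

/-- **The discrepancy is constant on each fibre** `{(A, α)}_{α ∈ Φ(A)^gp}`: every class is a difference of two
elements of `Φ(A)`, and pre-steps do not change the discrepancy. [cite: MochizukiFrdI2008, Thm. 5.2(iv) p.102] -/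
theorem baseDiscr_eq_of_base_eq (A : D) (α β : Algebra.GrothendieckGroup (Φ.obj (op A))) :
    pullGp Φ (e ⟨A, α⟩).inv (Ψ.obj ⟨A, α⟩).cls / α =
      pullGp Φ (e ⟨A, β⟩).inv (Ψ.obj ⟨A, β⟩).cls / β := by
  obtain ⟨x, y, hq⟩ := exists_cls_eq_div (⟨A, β / α⟩ : ModelFrobenioid Φ B DivB)
  dsimp only at x y hq
  have hαβ : α * Algebra.GrothendieckGroup.of x = β * Algebra.GrothendieckGroup.of y := by
    rw [div_eq_div_iff_mul_eq_mul] at hq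
    rw [mul_comm α, ← hq, mul_comm]
  rw [baseDiscr_eq_of_mul_of e hen hdeg hdiv hunit A α x,
    baseDiscr_eq_of_mul_of e hen hdeg hdiv hunit A β y, hαβ]

/-- **The discrepancy vanishes**: `(e_X⁻¹)^* cls(Ψ X) = cls(X)` — from `2 · c = c` on the fibre of `X`.
[cite: MochizukiFrdI2008, Thm. 5.2(iv) p.102] -/
theorem baseDiscr_eq_one (X : ModelFrobenioid Φ B DivB) :
    pullGp Φ (e X).inv (Ψ.obj X).cls / X.cls = 1 := by
  obtain ⟨A, α⟩ := X
  have h2 := baseDiscr_sq_eq_of_frobenius e hen hdeg hdiv hunit A α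
  rw [← baseDiscr_eq_of_base_eq e hen hdeg hdiv hunit A α (α ^ 2), pow_two] at h2
  have h : (pullGp Φ (e ⟨A, α⟩).inv (Ψ.obj ⟨A, α⟩).cls / α) *
      (pullGp Φ (e ⟨A, α⟩).inv (Ψ.obj ⟨A, α⟩).cls / α) =
      (pullGp Φ (e ⟨A, α⟩).inv (Ψ.obj ⟨A, α⟩).cls / α) * 1 := by
    rw [mul_one]
    exact h2
  exact mul_left_cancel h

/-- **The class of the image object is the transported class**: `cls(Ψ X) = e_X^* cls(X)` in
`Φ(Base Ψ X)^gp` — the object part of "`Ψ` is the identity". [cite: MochizukiFrdI2008, Thm. 5.2(iv) p.102] -/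
theorem cls_obj_eq_pullGp_of_over_base (X : ModelFrobenioid Φ B DivB) :
    (Ψ.obj X).cls = pullGp Φ (e X).hom X.cls := by
  have h := div_eq_one.mp (baseDiscr_eq_one e hen hdeg hdiv hunit X)
  calc (Ψ.obj X).cls = pullGp Φ ((e X).hom ≫ (e X).inv) (Ψ.obj X).cls := by
        rw [Iso.hom_inv_id, pullGp_id]
    _ = pullGp Φ (e X).hom X.cls := by rw [pullGp_comp, h]

end Discrepancy

section Rigidity

include hen

/-- **Rigidity of functors lying over the identity of the base (model-Frobenioid form of the [IUTchI]
Cor. 5.3 (iv) injectivity criterion / [FrdI] Thm. 5.2 (iv) + Prop. 5.6 units argument).**  A functor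
`Ψ : C ⥤ C` of the model Frobenioid `C` of `(Φ, B, Div_B)`, lying over the identity of `D` through a
natural family `e_X : Base(Ψ X) ⥲ Base(X)`, preserving Frobenius degrees and inducing through `e` the
identity on the divisor monoid (`Div(Ψ φ) = e_X^* Div(φ)`) and on the rational function monoid
(`u_{Ψ φ} = e_X^* u_φ`), is isomorphic to `𝟭_C` by an isomorphism with components `(1, e_X, 0, 1)`.
[cite: MochizukiFrdI2008, Thm. 5.2(iv) p.102] [cite: Mochizuki2012, Cor. 5.3(iv) p.145] -/
theorem exists_iso_id_of_over_base
    (hdeg : ∀ ⦃X Y : ModelFrobenioid Φ B DivB⦄ (φ : X ⟶ Y), degFr (Ψ.map φ) = degFr φ)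
    (hdiv : ∀ ⦃X Y : ModelFrobenioid Φ B DivB⦄ (φ : X ⟶ Y),
      div (Ψ.map φ) = pull Φ (e X).hom (div φ))
    (hunit : ∀ ⦃X Y : ModelFrobenioid Φ B DivB⦄ (φ : X ⟶ Y),
      unit (Ψ.map φ) = pull B (e X).hom (unit φ)) :
    ∃ ι : Ψ ≅ 𝟭 (ModelFrobenioid Φ B DivB), ∀ X : ModelFrobenioid Φ B DivB,
      degFr (ι.hom.app X) = 1 ∧ baseMap (ι.hom.app X) = (e X).hom ∧
        div (ι.hom.app X) = 1 ∧ unit (ι.hom.app X) = 1 := by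
  have hcls := cls_obj_eq_pullGp_of_over_base e hen hdeg hdiv hunit
  have hcls' : ∀ X : ModelFrobenioid Φ B DivB, X.cls = pullGp Φ (e X).inv (Ψ.obj X).cls := fun X =>
    (div_eq_one.mp (baseDiscr_eq_one e hen hdeg hdiv hunit X)).symm
  -- the components `(1, e_X, 0, 1) : Ψ X → X` and their inverses `(1, e_X⁻¹, 0, 1)`
  let θ : ∀ X : ModelFrobenioid Φ B DivB, Ψ.obj X ⟶ X := fun X =>
    { degFr := 1
      base := (e X).hom
      div := 1
      unit := 1
      rel := by rw [PNat.one_coe, pow_one, map_one, mul_one, map_one, mul_one]; exact hcls X }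
  let θ' : ∀ X : ModelFrobenioid Φ B DivB, X ⟶ Ψ.obj X := fun X =>
    { degFr := 1
      base := (e X).inv
      div := 1
      unit := 1
      rel := by rw [PNat.one_coe, pow_one, map_one, mul_one, map_one, mul_one]; exact hcls' X }
  have hθθ' : ∀ X, θ X ≫ θ' X = 𝟙 (Ψ.obj X) := fun X => by
    refine hom_ext (mul_one 1) (e X).hom_inv_id ?_ ?_
    · show (Φ.map (e X).hom.op).hom 1 * 1 ^ ((1 : ℕ+) : ℕ) = 1
      rw [map_one, one_pow, mul_one]
    · show (B.map (e X).hom.op).hom 1 * 1 ^ ((1 : ℕ+) : ℕ) = 1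
      rw [map_one, one_pow, mul_one]
  have hθ'θ : ∀ X, θ' X ≫ θ X = 𝟙 X := fun X => by
    refine hom_ext (mul_one 1) (e X).inv_hom_id ?_ ?_
    · show (Φ.map (e X).inv.op).hom 1 * 1 ^ ((1 : ℕ+) : ℕ) = 1
      rw [map_one, one_pow, mul_one]
    · show (B.map (e X).inv.op).hom 1 * 1 ^ ((1 : ℕ+) : ℕ) = 1
      rw [map_one, one_pow, mul_one]
  -- naturality: `(deg_Fr, Base, Div, u)` of `Ψ φ ≫ θ_Y` and `θ_X ≫ φ` agree by `hdeg`, `hen`, `hdiv`, `hunit`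
  have hnat : ∀ {X Y : ModelFrobenioid Φ B DivB} (φ : X ⟶ Y), Ψ.map φ ≫ θ Y = θ X ≫ φ := by
    intro X Y φ
    refine hom_ext ?_ (hen φ) ?_ ?_
    · show (1 : ℕ+) * degFr (Ψ.map φ) = degFr φ * 1
      rw [hdeg, one_mul, mul_one]
    · show (Φ.map (baseMap (Ψ.map φ)).op).hom 1 * div (Ψ.map φ) ^ ((1 : ℕ+) : ℕ) =
        (Φ.map (e X).hom.op).hom (div φ) * 1 ^ (degFr φ : ℕ)
      rw [map_one, one_mul, PNat.one_coe, pow_one, one_pow, mul_one, hdiv]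
      rfl
    · show (B.map (baseMap (Ψ.map φ)).op).hom 1 * unit (Ψ.map φ) ^ ((1 : ℕ+) : ℕ) =
        (B.map (e X).hom.op).hom (unit φ) * 1 ^ (degFr φ : ℕ)
      rw [map_one, one_mul, PNat.one_coe, pow_one, one_pow, mul_one, hunit]
      rfl
  refine ⟨NatIso.ofComponents (fun X => ⟨θ X, θ' X, hθθ' X, hθ'θ X⟩) (fun φ => hnat φ), fun X => ?_⟩
  exact ⟨rfl, rfl, rfl, rfl⟩

/-- The same, as a bare existence statement: `Ψ ≅ 𝟭_C`. [cite: MochizukiFrdI2008, Thm. 5.2(iv) p.102] -/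
theorem nonempty_iso_id_of_over_base
    (hdeg : ∀ ⦃X Y : ModelFrobenioid Φ B DivB⦄ (φ : X ⟶ Y), degFr (Ψ.map φ) = degFr φ)
    (hdiv : ∀ ⦃X Y : ModelFrobenioid Φ B DivB⦄ (φ : X ⟶ Y),
      div (Ψ.map φ) = pull Φ (e X).hom (div φ))
    (hunit : ∀ ⦃X Y : ModelFrobenioid Φ B DivB⦄ (φ : X ⟶ Y),
      unit (Ψ.map φ) = pull B (e X).hom (unit φ)) :
    Nonempty (Ψ ≅ 𝟭 (ModelFrobenioid Φ B DivB)) := by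
  obtain ⟨ι, -⟩ := exists_iso_id_of_over_base e hen hdeg hdiv hunit
  exact ⟨ι⟩

end Rigidity

section OverBaseIso

omit e hen

/-- **Rigidity, natural-isomorphism form**: a functor `Ψ : C ⥤ C` with an isomorphism
`η : Ψ ⋙ Base ≅ Base` ("`α` lies over the identity self-equivalence of `𝒟_v`"), preserving Frobenius
degrees and inducing through `η` the identity on the divisor and rational function monoids, is
isomorphic to `𝟭_C` by an isomorphism lying over `η` with trivial divisors and units.
[cite: MochizukiFrdI2008, Thm. 5.2(iv) p.102] [cite: Mochizuki2012, Cor. 5.3(iv) p.145] -/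
theorem exists_iso_id_of_over_baseIso (η : Ψ ⋙ baseFunctor Φ B DivB ≅ baseFunctor Φ B DivB)
    (hdeg : ∀ ⦃X Y : ModelFrobenioid Φ B DivB⦄ (φ : X ⟶ Y), degFr (Ψ.map φ) = degFr φ)
    (hdiv : ∀ ⦃X Y : ModelFrobenioid Φ B DivB⦄ (φ : X ⟶ Y),
      div (Ψ.map φ) = pull Φ (η.hom.app X : (Ψ.obj X).base ⟶ X.base) (div φ))
    (hunit : ∀ ⦃X Y : ModelFrobenioid Φ B DivB⦄ (φ : X ⟶ Y),
      unit (Ψ.map φ) = pull B (η.hom.app X : (Ψ.obj X).base ⟶ X.base) (unit φ)) :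
    ∃ ι : Ψ ≅ 𝟭 (ModelFrobenioid Φ B DivB), ∀ X : ModelFrobenioid Φ B DivB,
      degFr (ι.hom.app X) = 1 ∧
        baseMap (ι.hom.app X) = (η.hom.app X : (Ψ.obj X).base ⟶ X.base) ∧
          div (ι.hom.app X) = 1 ∧ unit (ι.hom.app X) = 1 :=
  exists_iso_id_of_over_base (fun X => η.app X) (fun _ _ φ => η.hom.naturality φ) hdeg hdiv hunit

/-- The same, as a bare existence statement. [cite: MochizukiFrdI2008, Thm. 5.2(iv) p.102] -/
theorem nonempty_iso_id_of_over_baseIso (η : Ψ ⋙ baseFunctor Φ B DivB ≅ baseFunctor Φ B DivB)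
    (hdeg : ∀ ⦃X Y : ModelFrobenioid Φ B DivB⦄ (φ : X ⟶ Y), degFr (Ψ.map φ) = degFr φ)
    (hdiv : ∀ ⦃X Y : ModelFrobenioid Φ B DivB⦄ (φ : X ⟶ Y),
      div (Ψ.map φ) = pull Φ (η.hom.app X : (Ψ.obj X).base ⟶ X.base) (div φ))
    (hunit : ∀ ⦃X Y : ModelFrobenioid Φ B DivB⦄ (φ : X ⟶ Y),
      unit (Ψ.map φ) = pull B (η.hom.app X : (Ψ.obj X).base ⟶ X.base) (unit φ)) :
    Nonempty (Ψ ≅ 𝟭 (ModelFrobenioid Φ B DivB)) := by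
  obtain ⟨ι, -⟩ := exists_iso_id_of_over_baseIso η hdeg hdiv hunit
  exact ⟨ι⟩

/-- **«FRDI-SELFEQUIV-RIGIDITY» — the printed shape** ([IUTchI] p. 145 l. 1–9 at the model Frobenioid of
[FrdI] Thm. 5.2): a self-equivalence `Ψ : C ≌ C` lying over the identity of `D` (`η : Ψ ⋙ Base ≅ Base`)
that preserves Frobenius degrees and induces the identity on the divisor monoid `Φ` and on the rational
function monoid `B` is isomorphic to the identity self-equivalence: `Nonempty (Ψ.functor ≅ 𝟭_C)`.
[cite: MochizukiFrdI2008, Thm. 5.2(iv) p.102] [cite: Mochizuki2012, Cor. 5.3(iv) p.145] -/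
theorem selfEquivalence_iso_id_of_over_base
    (Ψ : ModelFrobenioid Φ B DivB ≌ ModelFrobenioid Φ B DivB)
    (η : Ψ.functor ⋙ baseFunctor Φ B DivB ≅ baseFunctor Φ B DivB)
    (hdeg : ∀ ⦃X Y : ModelFrobenioid Φ B DivB⦄ (φ : X ⟶ Y), degFr (Ψ.functor.map φ) = degFr φ)
    (hdiv : ∀ ⦃X Y : ModelFrobenioid Φ B DivB⦄ (φ : X ⟶ Y),
      div (Ψ.functor.map φ) = pull Φ (η.hom.app X : (Ψ.functor.obj X).base ⟶ X.base) (div φ))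
    (hunit : ∀ ⦃X Y : ModelFrobenioid Φ B DivB⦄ (φ : X ⟶ Y),
      unit (Ψ.functor.map φ) = pull B (η.hom.app X : (Ψ.functor.obj X).base ⟶ X.base) (unit φ)) :
    Nonempty (Ψ.functor ≅ 𝟭 (ModelFrobenioid Φ B DivB)) :=
  nonempty_iso_id_of_over_baseIso η hdeg hdiv hunit

end OverBaseIso

end ModelFrobenioid

end Literature.AlgebraicGeometry.Frobenioids
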